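import Mathlib

/-!
# Strategist g4 sketch — the finite core of Theorem V (R1-FIN-MEMO §2, §5(d)), typed AND proved

`KCellVanishing` is the character-sum identity behind the vanishing of the `K_{t₂}`-cell of Wan's
Lemma 7.7 integral for `cond ϑ = q^s`, `s ≥ 2`: a Dirichlet character of conductor `q^s` with `s ≥ 2`
is non-trivial on the congruence subgroup `1 + qℤ/q^sℤ` (else it would factor through modulus `q`,
`DirichletCharacter.factorsThrough_iff_ker_unitsMap`), so its sum over that coset vanishes
(invariance of the sum under multiplication by a kernel element `u` with `χ u ≠ 1`).
Equivalently `Σ_{b mod q^{s-1}} Φ_f(n(b)) = 0` in the memo's notation. `lean check`: rc 0, 0 sorries.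
-/

namespace Summit.BirchSwinnertonDyer.BirchSwinnertonDyer.Cruxes.TwistPairGreenbergProductDivisibilitySplit.TorsplitR1fix

open scoped BigOperators

/-- Residue form of the finite core of Theorem V: a Dirichlet character mod `q^s` of exact
conductor `q^s` with `s ≥ 2` sums to zero over the residues `≡ 1 (mod q)`. -/
theorem charSum_congOne_eq_zero {q s : ℕ} (hq : q.Prime) (hs : 2 ≤ s) [NeZero (q ^ s)]
    (χ : DirichletCharacter ℂ (q ^ s)) (hχ : χ.conductor = q ^ s) (hd : q ∣ q ^ s) :
    (∑ y : ZMod (q ^ s), if ZMod.castHom hd (ZMod q) y = 1 then χ y else 0) = 0 := by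
  haveI : NeZero q := ⟨hq.ne_zero⟩
  set c := ZMod.castHom hd (ZMod q) with hc
  -- Step 1: `χ` is non-trivial on the kernel of reduction mod `q`.
  have hnot : ¬ (ZMod.unitsMap hd).ker ≤ χ.toUnitHom.ker := by
    intro hle
    have hft : χ.FactorsThrough q :=
      (DirichletCharacter.factorsThrough_iff_ker_unitsMap hd).mpr hle
    have hdvd : χ.conductor ∣ q :=
      DirichletCharacter.conductor_dvd_of_mem_conductorSet χ
        ((DirichletCharacter.mem_conductorSet_iff χ).mpr hft)
    rw [hχ] at hdvd
    have h1 : q ^ s ≤ q := Nat.le_of_dvd hq.pos hdvd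
    have h2 : q < q ^ s := by
      calc q = q ^ 1 := (pow_one q).symm
        _ < q ^ s := Nat.pow_lt_pow_right hq.one_lt (by omega)
    omega
  obtain ⟨u, hu, hχu⟩ := SetLike.not_le_iff_exists.mp hnot
  have hu1 : c (u : ZMod (q ^ s)) = 1 := by
    have := MonoidHom.mem_ker.mp hu
    rw [ZMod.unitsMap_def] at this
    have h := congrArg Units.val this
    simpa [hc, Units.coe_map] using h
  have hχu1 : χ (u : ZMod (q ^ s)) ≠ 1 := by
    intro h
    apply hχu
    rw [MonoidHom.mem_ker]
    ext
    rw [MulChar.coe_toUnitHom, h, Units.val_one]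
  -- Step 2: the sum is invariant under multiplication by `u`, hence zero.
  set T := ∑ y : ZMod (q ^ s), if c y = 1 then χ y else 0 with hT
  have hinv : χ (u : ZMod (q ^ s)) * T = T := by
    rw [hT, Finset.mul_sum]
    have step : ∀ y : ZMod (q ^ s),
        χ (u : ZMod (q ^ s)) * (if c y = 1 then χ y else 0)
          = (fun z => if c z = 1 then χ z else 0) ((u : ZMod (q ^ s)) * y) := by
      intro y
      have hcy : c ((u : ZMod (q ^ s)) * y) = c y := by rw [map_mul, hu1, one_mul]
      simp only [hcy]
      split_ifs with h
      · rw [map_mul]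
      · rw [mul_zero]
    simp_rw [step]
    exact Fintype.sum_equiv (Units.mulLeft u) _ _ (fun y => rfl)
  have hzero : (χ (u : ZMod (q ^ s)) - 1) * T = 0 := by rw [sub_mul, one_mul, hinv, sub_self]
  rcases mul_eq_zero.mp hzero with h | h
  · exact absurd (sub_eq_zero.mp h) hχu1
  · exact h

/-- Range form, as published in the strategist sketch (`KCellVanishing`). -/
def KCellVanishing : Prop :=
  ∀ (q s : ℕ), q.Prime → 2 ≤ s → ∀ χ : DirichletCharacter ℂ (q ^ s), χ.conductor = q ^ s →
    (∑ x ∈ Finset.range (q ^ s), if q ∣ x then χ (1 + (x : ZMod (q ^ s))) else 0) = 0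

/-- The finite core of Theorem V holds. -/
theorem kCellVanishing_holds : KCellVanishing := by
  intro q s hq hs χ hχ
  haveI : NeZero (q ^ s) := ⟨pow_ne_zero _ hq.ne_zero⟩
  haveI : NeZero q := ⟨hq.ne_zero⟩
  have hd : q ∣ q ^ s := dvd_pow_self q (by omega)
  have key := charSum_congOne_eq_zero hq hs χ hχ hd
  set c := ZMod.castHom hd (ZMod q) with hc
  -- (a) the range sum is a sum over `ZMod (q^s)`
  have hA : (∑ x ∈ Finset.range (q ^ s), if q ∣ x then χ (1 + (x : ZMod (q ^ s))) else 0)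
      = ∑ y : ZMod (q ^ s), if q ∣ y.val then χ (1 + y) else 0 := by
    refine Finset.sum_bij' (fun x _ => (x : ZMod (q ^ s))) (fun y _ => y.val) ?_ ?_ ?_ ?_ ?_
    · intro x _; exact Finset.mem_univ _
    · intro y _; exact Finset.mem_range.mpr (ZMod.val_lt y)
    · intro x hx; exact ZMod.val_natCast_of_lt (Finset.mem_range.mp hx)
    · intro y _; exact ZMod.natCast_zmod_val y
    · intro x hx; rw [ZMod.val_natCast_of_lt (Finset.mem_range.mp hx)]
  -- (b) shift by `1` and translate the divisibility condition
  have hB : (∑ y : ZMod (q ^ s), if q ∣ y.val then χ (1 + y) else 0)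
      = ∑ z : ZMod (q ^ s), if c z = 1 then χ z else 0 := by
    conv_rhs => rw [← Equiv.sum_comp (Equiv.addLeft (1 : ZMod (q ^ s)))]
    refine Finset.sum_congr rfl (fun y _ => ?_)
    have hcond : (q ∣ y.val) ↔ c (1 + y) = 1 := by
      rw [map_add, map_one, add_eq_left, hc, ZMod.castHom_apply, ZMod.cast_eq_val,
        ZMod.natCast_eq_zero_iff]
    simp only [Equiv.coe_addLeft]
    by_cases h : q ∣ y.val
    · rw [if_pos h, if_pos (hcond.mp h)]
    · rw [if_neg h, if_neg (fun h' => h (hcond.mpr h'))]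
  rw [hA, hB]
  exact key

end Summit.BirchSwinnertonDyer.BirchSwinnertonDyer.Cruxes.TwistPairGreenbergProductDivisibilitySplit.TorsplitR1fix
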